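/-
Copyright (c) 2026 the pub-hodgecm-mathlib formalisation cell (harness21).  Prover seat hodgecm-mathlib-K2Liu-p09 (g5): Track B «K2-LIT»,
hLiu418 = stmt-HodgeConjecture-24832; LEAD F0P6-plan RULINGS M-156m∕o, M-157a (4)∕c «A7 = GK COCYCLE ROAD», file B4d-1b.
-/
import Summits.HodgeConjecture.HodgeConjecture.Theorems.K2LiuDoubledUTwoTwoLeviTransport          -- ★ B1b-2c (p03): (L1)(L2) for `φ(m(A))`, `φ(t(a,b))`
import Summits.HodgeConjecture.HodgeConjecture.Theorems.K2LiuSiegelCocycleStepLong                 -- ★ B4d-1 `apply_weylTwo_uLongTwo` (+ B4c-1∕2∕3, B1b-2a)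
import Summits.HodgeConjecture.HodgeConjecture.Theorems.K2LiuLocalSiegelCharacterMul               -- ★ `localSiegelCharacter_mul`
import Summits.HodgeConjecture.HodgeConjecture.Theorems.K2LiuGKRankOneIdentityLFactor              -- ★ `prod_norm_toPlace_eq_sq` (+ `chiF`)
import Literature.NumberTheory.K2Lit.LocalSiegelIntertwining                                        -- ★ D10 `IsLocalSiegelSection`, `apply_unipDeltaLocal_mul`
import HarnessLib

/-!
# Crux `HLiu418`, road `K2_Liu`, organ A7-reg (GK cocycle road), file B4d-1b:
# SIEGEL SECTIONS AND THE TRANSPORTED LETTERS — (N), (T), the torus character on coordinates, the long-root relation in `F_v`-coordinates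

Cell `hodgecm-mathlib`, crux item hLiu418 = `stmt-HodgeConjecture-24832`; squad K2 ∕ K2Liu; prover K2Liu-p09 (g5).  THEOREMS ONLY (no `def`, no instance,
no notation, no named-fact hypothesis, no `sorry`); lane `--supports stmt-HodgeConjecture-24832` (count-neutral helper).  ONE FRAME (RULING M-156o (c)):
`φ := frameConj Q ∘ toLocalFour` (★ B1b-1, K2Liu-p03 (g6)); the adapted-frame binders `D Dinv hDD hQm` are those of ★ B1b-1∕B1b-2c.
THE POINT.  ★ B4d-1∕B4d-2 derive the `SL₂` relations and equivariance words of the rank-one steps of `M_v(s) = A₂ A₁ A₂` for ANY `F : H_v → ℂ` with (N) invariance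
under the transported unipotent letters and (T) a torus law `F(φ(t(a,b)) g) = θ a b F g`.  Here (N) and (T) are discharged for a Siegel section `f ∈ I_v(s, χ_v)`
(★ D10), `θ a b := χ_s(φ t(a,b)) := localSiegelCharacter χ_v s (φ(t(a,b)))`, and that character is computed on the COORDINATES the rank-one operators use:
* §1 (N): `f(φ(n(X)) g) = f g` for every skew block `X` (★ B1b-1 `frameConj_nSiegel_mem_unipDeltaLocal` + ★ D10 `apply_unipDeltaLocal_mul`), hence for the root
  letters `u_{2e₂}`, `u_{e₁+e₂}`, `u_{2e₁}`; and `f(φ(u_{e₁−e₂}(z)) g) = f g` (a Levi unipotent: ★ B1b-2c (L2) with `det = 1`).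
* §2 (T): `f(φ(t(a,b)) g) = χ_s(φ t(a,b)) f g` (★ B1b-2c (L1)); `χ_s(φ t(a,b)) = χ_s(φ t(a,1)) χ_s(φ t(b,1))`, multiplicative and inverse-respecting.
* §3 the skew unit `X = ι_v(x)·δ` of `x ∈ F_vˣ` and **`χ_s(φ t(ι_v(x⁻¹), 1)) = χ_{F,v}(x)⁻¹ · |x|_v^{−(2s+2)}`** (★ B1b-2c (L2) + ★ `prod_norm_toPlace_eq_sq`).
* §4 **the long-root relation in `F_v`-coordinates**: `u(y) := φ(u_{2e₂}(ι_v(y)δ))` is additive, `ū(t) := φ(w₂) φ(u_{2e₂}(ι_v(t)δ⁻¹)) φ(w₂)`, and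
  `F(φ(w₂) u(x) g) = θ 1 (−X⁻¹) · F(ū(x⁻¹) g)` (★ B4d-1 at `X`); for a Siegel section **`θ 1 (−X⁻¹) = χ_s(φ t(1, −δ⁻¹)) · χ_{F,v}(x)⁻¹ · |x|_v^{−(2s+2)}`** —
  the `(C₀, ν, e) = (χ_s(φ t(1,−δ⁻¹)), χ_{F,v}, 2s+2)` datum of the `hrel` binder of ★ `K2LiuRankOneOperators.integrable_and_integral_eq` for the first `α₂`-step.
HONEST LABEL.  `HC_CM` is proved only modulo the 7 printed citations (2 remaining named inputs: hLiu418 = `stmt-HodgeConjecture-24832`,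
h413 = `stmt-HodgeConjecture-24833`) until rung 0 closes.

## References
* [Casselman1980] W. Casselman, *The unramified principal series of p-adic groups I*, Compositio Math. 40 (1980), §3.
* [HarrisKudlaSweet1996] M. Harris, S. Kudla, W. J. Sweet, J. AMS 9 (1996), §1 (1.11)–(1.15), §6 (6.14).
* [KudlaSweet1997] S. Kudla, W. J. Sweet, Israel J. Math. 98 (1997), §1.
* [CasselsFrohlichANT1967] J. W. S. Cassels, A. Fröhlich (eds.), *Algebraic Number Theory* (1967), Ch. II §10–§11.
-/

set_option autoImplicit false
set_option linter.dupNamespace false -- the mandated namespace repeats `HodgeConjecture.HodgeConjecture`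

noncomputable section

open NumberField IsDedekindDomain Matrix
open scoped NNReal
open Literature.NumberTheory.GaloisRepresentations.IsNonarchimedeanLocalField
open Literature.NumberTheory.Automorphic Literature.NumberTheory.Automorphic.UnitaryGroup
open Literature.NumberTheory.GelbartRogawski1991.AdaptedBlocks
open Literature.NumberTheory.GelbartRogawski1991.UnitaryDualPair.LocalSplitting
open Literature.NumberTheory.K2Lit.LocalSiegelDoubled
open Summit.HodgeConjecture.HodgeConjecture.Cruxes.HLiu418.K2LiuLocalLFactorDefs
open Summit.HodgeConjecture.HodgeConjecture.Cruxes.HLiu418.K2LiuLocalSiegelIwasawaFrame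
open Summit.HodgeConjecture.HodgeConjecture.Cruxes.HLiu418.K2LiuLocalSiegelIwasawa
open Summit.HodgeConjecture.HodgeConjecture.Cruxes.HLiu418.K2LiuLocalSiegel
open Summit.HodgeConjecture.HodgeConjecture.Cruxes.HLiu418.K2LiuGKRankOneIdentityLFactor
open Summit.HodgeConjecture.HodgeConjecture.Cruxes.HLiu418.K2LiuDoubledUTwoTwoBorelFrame
open Summit.HodgeConjecture.HodgeConjecture.Cruxes.HLiu418.K2LiuDoubledUTwoTwoWeylCocycle
open Summit.HodgeConjecture.HodgeConjecture.Cruxes.HLiu418.K2LiuDoubledUTwoTwoLevi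
open Summit.HodgeConjecture.HodgeConjecture.Cruxes.HLiu418.K2LiuDoubledUTwoTwoFrameTransport
open Summit.HodgeConjecture.HodgeConjecture.Cruxes.HLiu418.K2LiuDoubledUTwoTwoLeviTransport
open Summit.HodgeConjecture.HodgeConjecture.Cruxes.HLiu418.K2LiuDoubledUTwoTwoRankOneRelations
open Summit.HodgeConjecture.HodgeConjecture.Cruxes.HLiu418.K2LiuDoubledUTwoTwoRankOneRelationsLevi
open Summit.HodgeConjecture.HodgeConjecture.Cruxes.HLiu418.K2LiuUnipDeltaRankOneCoordinates
open Summit.HodgeConjecture.HodgeConjecture.Cruxes.HLiu418.K2LiuSiegelCocycleStepLong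

namespace Summit.HodgeConjecture.HodgeConjecture.Cruxes.HLiu418.K2LiuSiegelCocycleLetters

variable (F : Type) [Field F] [NumberField F] (E : Type) [Field E] [NumberField E] [Algebra F E]
  [Algebra.IsQuadraticExtension F E] (c : E ≃ₐ[F] E)
  {δ : E} (hcδ : c δ = -δ) (hδ : δ ≠ 0) {d : F} (hd : δ * δ = algebraMap F E d) (v : HeightOneSpectrum (𝓞 F))
  {T₂ : Matrix (Fin 2) (Fin 2) F} (hT₂ : T₂.IsSymm) {J₂D : Matrix (Fin (2 + 2)) (Fin (2 + 2)) E} (hJ₂D : J₂D = (gramD F 2 T₂).map (algebraMap F E))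
  (D Dinv : Matrix (Fin 2) (Fin 2) F) (hDD : D * Dinv = 1) (Q : GL (Fin (2 + 2)) F)
  (hQm : (Q : Matrix (Fin (2 + 2)) (Fin (2 + 2)) F) = Matrix.reindex (e₂ 2) (e₂ 2) (Matrix.fromBlocks 1 D 1 (-D)))
  (hQ : (Q : Matrix (Fin (2 + 2)) (Fin (2 + 2)) F)ᵀ * gramD F 2 T₂ * (Q : Matrix (Fin (2 + 2)) (Fin (2 + 2)) F) = (StdForm.antidiagonal (2 + 2)).over F)

/-! ## §1 (N): a Siegel section is left-invariant under the transported unipotent letters -/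

section Unipotent

variable {χv : ∀ w : PlacesOver E v, (w.1.adicCompletion E)ˣ →* ℂˣ} {s : ℂ} {f : UnitaryGroup.localPi E c (2 + 2) J₂D v → ℂ}
  (hf : IsLocalSiegelSection F E c hcδ hδ hd v 2 hT₂ hJ₂D χv s f)

include hJ₂D hDD hQm hf in
/-- **(N) for the block letter**: `f(φ(n(X)) g) = f g` for every skew `X` — `φ(n(X)) ∈ N_Δ(F_v)` (★ B1b-1) and Siegel sections are
left-`N_Δ`-invariant (★ D10). [cite: HarrisKudlaSweet1996, §1 (1.11), (1.15)] -/
theorem apply_frameConj_nSiegelBlk (X : Matrix (Fin 2) (Fin 2) (UnitaryGroup.LocalRing E v))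
    (hX : IsSkewTwo (UnitaryGroup.LocalRing E v) (UnitaryGroup.conjLocal E c v) X) (g : UnitaryGroup.localPi E c (2 + 2) J₂D v) :
    f (FrameTransport.frameConj F E c v (2 + 2) hJ₂D (antidiagonal_over_eq_map F E 2) Q hQ (toLocalFour F E c v (nSiegelBlk (UnitaryGroup.LocalRing E v) (UnitaryGroup.conjLocal E c v) hX)) * g) = f g := by
  obtain ⟨e10, e00, -, e01⟩ := hX.entries
  have hx : UnitaryGroup.conjLocal E c v (X 1 0) = -X 1 0 := eq_neg_of_add_eq_zero_left e10
  have hy : UnitaryGroup.conjLocal E c v (X 0 1) = -X 0 1 := eq_neg_of_add_eq_zero_left e01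
  have h11 : X 1 1 = -UnitaryGroup.conjLocal E c v (X 0 0) := eq_neg_of_add_eq_zero_right e00
  have hXe : X = !![X 0 0, X 0 1; X 1 0, -UnitaryGroup.conjLocal E c v (X 0 0)] := by
    rw [← h11]; exact Matrix.eta_fin_two X
  rw [nSiegelBlk_congr (UnitaryGroup.LocalRing E v) (UnitaryGroup.conjLocal E c v) hX
      (isSkewTwo_coords (UnitaryGroup.conjLocal_conjLocal c v hcδ hδ) (X 1 0) (X 0 0) (X 0 1) hx hy) hXe,
    ← nSiegel_eq_nSiegelBlk]
  exact apply_unipDeltaLocal_mul hf (frameConj_nSiegel_mem_unipDeltaLocal F E c hcδ hδ v hJ₂D D Dinv hDD Q hQm hQ _ _ _ hx hy) g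

include hJ₂D hDD hQm hf in
/-- **(N) for `u_{2e₂}`**: `f(φ(u_{2e₂}(x)) g) = f g` (`u_{2e₂}(x) = n(x, 0, 0)`). [cite: HarrisKudlaSweet1996, §1 (1.11), (1.15)] -/
theorem apply_frameConj_uLongTwo (x : UnitaryGroup.LocalRing E v) (hx : UnitaryGroup.conjLocal E c v x = -x)
    (g : UnitaryGroup.localPi E c (2 + 2) J₂D v) :
    f (FrameTransport.frameConj F E c v (2 + 2) hJ₂D (antidiagonal_over_eq_map F E 2) Q hQ (toLocalFour F E c v (uLongTwo (UnitaryGroup.LocalRing E v) (UnitaryGroup.conjLocal E c v) x hx)) * g) = f g := by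
  have h := apply_unipDeltaLocal_mul hf (frameConj_nSiegel_mem_unipDeltaLocal F E c hcδ hδ v hJ₂D D Dinv hDD Q hQm hQ x 0 0 hx
    (by rw [map_zero, neg_zero])) g
  rwa [nSiegel, uPlus_zero, uLongOne_zero, mul_one, mul_one] at h

include hJ₂D hDD hQm hf in
/-- **(N) for `u_{e₁+e₂}`**: `f(φ(u_{e₁+e₂}(z)) g) = f g` (`u_{e₁+e₂}(z) = n(0, z, 0)`). [cite: HarrisKudlaSweet1996, §1 (1.11), (1.15)] -/
theorem apply_frameConj_uPlus (z : UnitaryGroup.LocalRing E v) (g : UnitaryGroup.localPi E c (2 + 2) J₂D v) :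
    f (FrameTransport.frameConj F E c v (2 + 2) hJ₂D (antidiagonal_over_eq_map F E 2) Q hQ (toLocalFour F E c v (uPlus (UnitaryGroup.LocalRing E v) (UnitaryGroup.conjLocal E c v) (UnitaryGroup.conjLocal_conjLocal c v hcδ hδ) z)) * g) =
      f g := by
  have h := apply_unipDeltaLocal_mul hf (frameConj_nSiegel_mem_unipDeltaLocal F E c hcδ hδ v hJ₂D D Dinv hDD Q hQm hQ 0 z 0
    (by rw [map_zero, neg_zero]) (by rw [map_zero, neg_zero])) g
  rwa [nSiegel, uLongTwo_zero, uLongOne_zero, one_mul, mul_one] at h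

include hJ₂D hDD hQm hf in
/-- **(N) for `u_{2e₁}`**: `f(φ(u_{2e₁}(y)) g) = f g` (`u_{2e₁}(y) = n(0, 0, y)`). [cite: HarrisKudlaSweet1996, §1 (1.11), (1.15)] -/
theorem apply_frameConj_uLongOne (y : UnitaryGroup.LocalRing E v) (hy : UnitaryGroup.conjLocal E c v y = -y)
    (g : UnitaryGroup.localPi E c (2 + 2) J₂D v) :
    f (FrameTransport.frameConj F E c v (2 + 2) hJ₂D (antidiagonal_over_eq_map F E 2) Q hQ (toLocalFour F E c v (uLongOne (UnitaryGroup.LocalRing E v) (UnitaryGroup.conjLocal E c v) y hy)) * g) = f g := by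
  have h := apply_unipDeltaLocal_mul hf (frameConj_nSiegel_mem_unipDeltaLocal F E c hcδ hδ v hJ₂D D Dinv hDD Q hQm hQ 0 0 y
    (by rw [map_zero, neg_zero]) hy) g
  rwa [nSiegel, uLongTwo_zero, uPlus_zero, one_mul, one_mul] at h

include hJ₂D hDD hQm hf in
/-- **(N) for the Levi root letter `u_{e₁−e₂}`**: `f(φ(u₋(z)) g) = f g` — `u₋(z) = m(U)`, `U = (1 z; 0 1)` (★ B4c-2), `φ(m(U)) ∈ P_Δ(F_v)` with
`χ_s(φ m(U)) = (∏_w χ_w((det U)_w)) · (∏_w ‖(det U)_w‖)^{s+1} = 1` since `det U = 1` (★ B1b-2c (L1)(L2)). [cite: Casselman1980, §3] [cite: HarrisKudlaSweet1996, §1 (1.15)] -/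
theorem apply_frameConj_uMinus (z : UnitaryGroup.LocalRing E v) (g : UnitaryGroup.localPi E c (2 + 2) J₂D v) :
    f (FrameTransport.frameConj F E c v (2 + 2) hJ₂D (antidiagonal_over_eq_map F E 2) Q hQ (toLocalFour F E c v (uMinus (UnitaryGroup.LocalRing E v) (UnitaryGroup.conjLocal E c v) (UnitaryGroup.conjLocal_conjLocal c v hcδ hδ) z)) * g) =
      f g := by
  let U : GL (Fin 2) (UnitaryGroup.LocalRing E v) := ⟨!![1, z; 0, 1], !![1, -z; 0, 1],
    by ext i j; fin_cases i <;> fin_cases j <;> simp [Matrix.mul_apply, Fin.sum_univ_two],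
    by ext i j; fin_cases i <;> fin_cases j <;> simp [Matrix.mul_apply, Fin.sum_univ_two]⟩
  have hdet : Matrix.GeneralLinearGroup.det U = 1 := Units.ext (by simp [Matrix.GeneralLinearGroup.val_det_apply, U, Matrix.det_fin_two_of])
  have hdet' : ((U.1 : Matrix (Fin 2) (Fin 2) (UnitaryGroup.LocalRing E v))).det = 1 := by
    simpa [Matrix.GeneralLinearGroup.val_det_apply] using congrArg Units.val hdet
  rw [← leviElt_eq_uMinus (UnitaryGroup.conjLocal_conjLocal c v hcδ hδ) z U rfl,
    hf _ (isSiegelDelta_frameConj_leviElt F E c hcδ hδ hd v hT₂ hJ₂D D Dinv hDD Q hQm hQ U) g,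
    localSiegelCharacter_frameConj_leviElt F E c hcδ hδ v hJ₂D D Dinv hDD Q hQm hQ χv s U, hdet, hdet']
  simp

end Unipotent

/-! ## §2 (T): the torus law of a Siegel section and the torus character `χ_s(φ t(a,b))` -/

section Torus

variable (χv : ∀ w : PlacesOver E v, (w.1.adicCompletion E)ˣ →* ℂˣ) (s : ℂ)

include hJ₂D hDD hQm in
/-- **(T)**: `f(φ(t(a,b)) g) = χ_s(φ t(a,b)) · f g` for a Siegel section `f` (★ B1b-2c (L1): `φ t(a,b) ∈ P_Δ(F_v)`). [cite: HarrisKudlaSweet1996, §1 (1.15)] -/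
theorem apply_frameConj_torusElt {f : UnitaryGroup.localPi E c (2 + 2) J₂D v → ℂ} (hf : IsLocalSiegelSection F E c hcδ hδ hd v 2 hT₂ hJ₂D χv s f)
    (a b : (UnitaryGroup.LocalRing E v)ˣ) (g : UnitaryGroup.localPi E c (2 + 2) J₂D v) :
    f (FrameTransport.frameConj F E c v (2 + 2) hJ₂D (antidiagonal_over_eq_map F E 2) Q hQ (toLocalFour F E c v (torusElt (UnitaryGroup.LocalRing E v) (UnitaryGroup.conjLocal E c v) (UnitaryGroup.conjLocal_conjLocal c v hcδ hδ) a b)) * g) =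
      localSiegelCharacter F E c v 2 χv s (FrameTransport.frameConj F E c v (2 + 2) hJ₂D (antidiagonal_over_eq_map F E 2) Q hQ (toLocalFour F E c v (torusElt (UnitaryGroup.LocalRing E v) (UnitaryGroup.conjLocal E c v) (UnitaryGroup.conjLocal_conjLocal c v hcδ hδ) a b))) * f g :=
  hf _ (isSiegelDelta_frameConj_torusElt F E c hcδ hδ hd v hT₂ hJ₂D D Dinv hDD Q hQm hQ a b) g

include hd hT₂ hJ₂D hDD hQm in
/-- **the torus character is multiplicative**: `χ_s(φ t(aa′, bb′)) = χ_s(φ t(a,b)) · χ_s(φ t(a′,b′))` (★ `torusElt_mul`, ★ `localSiegelCharacter_mul`).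
[cite: HarrisKudlaSweet1996, §1 (1.15)] -/
theorem localSiegelCharacter_frameConj_torusElt_mul (a b a' b' : (UnitaryGroup.LocalRing E v)ˣ) :
    localSiegelCharacter F E c v 2 χv s (FrameTransport.frameConj F E c v (2 + 2) hJ₂D (antidiagonal_over_eq_map F E 2) Q hQ (toLocalFour F E c v (torusElt (UnitaryGroup.LocalRing E v) (UnitaryGroup.conjLocal E c v) (UnitaryGroup.conjLocal_conjLocal c v hcδ hδ) (a * a') (b * b')))) =
      localSiegelCharacter F E c v 2 χv s (FrameTransport.frameConj F E c v (2 + 2) hJ₂D (antidiagonal_over_eq_map F E 2) Q hQ (toLocalFour F E c v (torusElt (UnitaryGroup.LocalRing E v) (UnitaryGroup.conjLocal E c v) (UnitaryGroup.conjLocal_conjLocal c v hcδ hδ) a b))) *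
        localSiegelCharacter F E c v 2 χv s (FrameTransport.frameConj F E c v (2 + 2) hJ₂D (antidiagonal_over_eq_map F E 2) Q hQ (toLocalFour F E c v (torusElt (UnitaryGroup.LocalRing E v) (UnitaryGroup.conjLocal E c v) (UnitaryGroup.conjLocal_conjLocal c v hcδ hδ) a' b'))) := by
  rw [← torusElt_mul, map_mul, map_mul]
  exact localSiegelCharacter_mul F E c hcδ hδ hd v 2 hT₂ hJ₂D χv s _ _
    (isSiegelDelta_frameConj_torusElt F E c hcδ hδ hd v hT₂ hJ₂D D Dinv hDD Q hQm hQ a b)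
    (isSiegelDelta_frameConj_torusElt F E c hcδ hδ hd v hT₂ hJ₂D D Dinv hDD Q hQm hQ a' b')

include hJ₂D hDD hQm in
/-- `χ_s(φ t(1, b)) = χ_s(φ t(b, 1))` (the character only sees `det = ab`). [cite: HarrisKudlaSweet1996, §1 (1.15)] -/
theorem localSiegelCharacter_frameConj_torusElt_one_left (b : (UnitaryGroup.LocalRing E v)ˣ) :
    localSiegelCharacter F E c v 2 χv s (FrameTransport.frameConj F E c v (2 + 2) hJ₂D (antidiagonal_over_eq_map F E 2) Q hQ (toLocalFour F E c v (torusElt (UnitaryGroup.LocalRing E v) (UnitaryGroup.conjLocal E c v) (UnitaryGroup.conjLocal_conjLocal c v hcδ hδ) 1 b))) =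
      localSiegelCharacter F E c v 2 χv s (FrameTransport.frameConj F E c v (2 + 2) hJ₂D (antidiagonal_over_eq_map F E 2) Q hQ (toLocalFour F E c v (torusElt (UnitaryGroup.LocalRing E v) (UnitaryGroup.conjLocal E c v) (UnitaryGroup.conjLocal_conjLocal c v hcδ hδ) b 1))) := by
  rw [localSiegelCharacter_frameConj_torusElt F E c hcδ hδ v hJ₂D D Dinv hDD Q hQm hQ χv s 1 b,
    localSiegelCharacter_frameConj_torusElt F E c hcδ hδ v hJ₂D D Dinv hDD Q hQm hQ χv s b 1, one_mul, mul_one]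
  simp only [Units.val_one, Pi.one_apply, one_mul, mul_one]

include hd hT₂ hJ₂D hDD hQm in
/-- **`χ_s(φ t(a,b)) = χ_s(φ t(a,1)) · χ_s(φ t(b,1))`** — the torus law in the «two one-variable characters» form the rank-one steps consume.
[cite: HarrisKudlaSweet1996, §1 (1.15)] [cite: Casselman1980, §3] -/
theorem localSiegelCharacter_frameConj_torusElt_eq_mul (a b : (UnitaryGroup.LocalRing E v)ˣ) :
    localSiegelCharacter F E c v 2 χv s (FrameTransport.frameConj F E c v (2 + 2) hJ₂D (antidiagonal_over_eq_map F E 2) Q hQ (toLocalFour F E c v (torusElt (UnitaryGroup.LocalRing E v) (UnitaryGroup.conjLocal E c v) (UnitaryGroup.conjLocal_conjLocal c v hcδ hδ) a b))) =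
      localSiegelCharacter F E c v 2 χv s (FrameTransport.frameConj F E c v (2 + 2) hJ₂D (antidiagonal_over_eq_map F E 2) Q hQ (toLocalFour F E c v (torusElt (UnitaryGroup.LocalRing E v) (UnitaryGroup.conjLocal E c v) (UnitaryGroup.conjLocal_conjLocal c v hcδ hδ) a 1))) *
        localSiegelCharacter F E c v 2 χv s (FrameTransport.frameConj F E c v (2 + 2) hJ₂D (antidiagonal_over_eq_map F E 2) Q hQ (toLocalFour F E c v (torusElt (UnitaryGroup.LocalRing E v) (UnitaryGroup.conjLocal E c v) (UnitaryGroup.conjLocal_conjLocal c v hcδ hδ) b 1))) := by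
  rw [← localSiegelCharacter_frameConj_torusElt_one_left F E c hcδ hδ v hJ₂D D Dinv hDD Q hQm hQ χv s b,
    ← localSiegelCharacter_frameConj_torusElt_mul F E c hcδ hδ hd v hT₂ hJ₂D D Dinv hDD Q hQm hQ χv s a 1 1 b, mul_one, one_mul]

include hd hT₂ hJ₂D hDD hQm in
/-- `χ_s(φ t(1,1)) = 1` and hence **`χ_s(φ t(a⁻¹, 1)) = χ_s(φ t(a, 1))⁻¹`**. [cite: HarrisKudlaSweet1996, §1 (1.15)] -/
theorem localSiegelCharacter_frameConj_torusElt_inv (a : (UnitaryGroup.LocalRing E v)ˣ) :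
    localSiegelCharacter F E c v 2 χv s (FrameTransport.frameConj F E c v (2 + 2) hJ₂D (antidiagonal_over_eq_map F E 2) Q hQ (toLocalFour F E c v (torusElt (UnitaryGroup.LocalRing E v) (UnitaryGroup.conjLocal E c v) (UnitaryGroup.conjLocal_conjLocal c v hcδ hδ) a⁻¹ 1))) =
      (localSiegelCharacter F E c v 2 χv s (FrameTransport.frameConj F E c v (2 + 2) hJ₂D (antidiagonal_over_eq_map F E 2) Q hQ (toLocalFour F E c v (torusElt (UnitaryGroup.LocalRing E v) (UnitaryGroup.conjLocal E c v) (UnitaryGroup.conjLocal_conjLocal c v hcδ hδ) a 1))))⁻¹ := by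
  have hone : localSiegelCharacter F E c v 2 χv s (FrameTransport.frameConj F E c v (2 + 2) hJ₂D (antidiagonal_over_eq_map F E 2) Q hQ (toLocalFour F E c v (torusElt (UnitaryGroup.LocalRing E v) (UnitaryGroup.conjLocal E c v) (UnitaryGroup.conjLocal_conjLocal c v hcδ hδ) 1 1))) = 1 := by
    rw [localSiegelCharacter_frameConj_torusElt F E c hcδ hδ v hJ₂D D Dinv hDD Q hQm hQ χv s 1 1]
    simp
  have h := localSiegelCharacter_frameConj_torusElt_mul F E c hcδ hδ hd v hT₂ hJ₂D D Dinv hDD Q hQm hQ χv s a⁻¹ 1 a 1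
  rw [inv_mul_cancel, mul_one, hone] at h
  exact eq_inv_of_mul_eq_one_left h.symm

end Torus

/-! ## §3 Coordinates: the skew unit `X = ι_v(x)·δ` of `x ∈ F_vˣ`, and the torus character on `ι_v(F_vˣ)` -/

section Coordinates

variable (χv : ∀ w : PlacesOver E v, (w.1.adicCompletion E)ˣ →* ℂˣ) (s : ℂ)

/-- Mathlib's norm on `F_v` is the normalised absolute value `normAbs` (the tree's `norm_eq_coe_normAbs`, re-derived to keep the import closure
small, as in ★ `K2LiuFlatSiegelFamilies`). [folklore] -/
theorem norm_eq_coe_normAbs (x : v.adicCompletion F) : ‖x‖ = ((normAbs (v.adicCompletion F) x : ℝ≥0) : ℝ) := by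
  by_cases hx : x = 0
  · rw [hx, norm_zero, map_zero, NNReal.coe_zero]
  have hv : Valued.v x ≠ 0 := (Valuation.ne_zero_iff _).2 hx
  have hxn : Valued.v x = WithZero.exp (Multiplicative.toAdd (WithZero.unzero hv)) := by
    rw [WithZero.exp, ofAdd_toAdd, WithZero.coe_unzero]
  rw [FinitePlace.norm_def, WithZeroMulInt.toNNReal_neg_apply _ hv,
    normAbs_eq_inv_zpow_of_valued_eq v hxn, residueFieldCard_adicCompletion_eq, _root_.inv_zpow', neg_neg]
  rfl

omit [Algebra.IsQuadraticExtension F E] in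
/-- the coercion of the coordinate unit: `↑(ι_v(x) · δ) = ι_v x · (δ ⊗ 1)`. [cite: CasselsFrohlichANT1967, Ch. II §10] -/
theorem val_coordUnit (x : (v.adicCompletion F)ˣ) :
    ((Units.map (UnitaryGroup.toLocalRing E v : v.adicCompletion F →* UnitaryGroup.LocalRing E v) x *
        (Units.mk0 δ hδ).map (algebraMap E (UnitaryGroup.LocalRing E v) : E →* UnitaryGroup.LocalRing E v) : (UnitaryGroup.LocalRing E v)ˣ) :
        UnitaryGroup.LocalRing E v) =
      UnitaryGroup.toLocalRing E v (x : v.adicCompletion F) * algebraMap E (UnitaryGroup.LocalRing E v) δ := rfl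

omit [Algebra.IsQuadraticExtension F E] in
/-- **`−X⁻¹ = ι_v(x⁻¹) · (−δ⁻¹)`** for the coordinate unit `X = ι_v(x)·δ`. [cite: CasselsFrohlichANT1967, Ch. II §10] -/
theorem neg_inv_coordUnit (x : (v.adicCompletion F)ˣ) :
    -(Units.map (UnitaryGroup.toLocalRing E v : v.adicCompletion F →* UnitaryGroup.LocalRing E v) x *
        (Units.mk0 δ hδ).map (algebraMap E (UnitaryGroup.LocalRing E v) : E →* UnitaryGroup.LocalRing E v))⁻¹ =
      Units.map (UnitaryGroup.toLocalRing E v : v.adicCompletion F →* UnitaryGroup.LocalRing E v) x⁻¹ *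
        -((Units.mk0 δ hδ).map (algebraMap E (UnitaryGroup.LocalRing E v) : E →* UnitaryGroup.LocalRing E v))⁻¹ := by
  rw [mul_inv, map_inv, mul_neg]

omit [Algebra.IsQuadraticExtension F E] in
include hcδ in
/-- `σ(ι_v(t) · δ⁻¹) = −(ι_v(t) · δ⁻¹)`: the `ū`-letter's argument is skew. [cite: CasselsFrohlichANT1967, Ch. II §10] -/
theorem conjLocal_coord_inv (t : v.adicCompletion F) :
    UnitaryGroup.conjLocal E c v (UnitaryGroup.toLocalRing E v t * algebraMap E (UnitaryGroup.LocalRing E v) δ⁻¹) =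
      -(UnitaryGroup.toLocalRing E v t * algebraMap E (UnitaryGroup.LocalRing E v) δ⁻¹) := by
  rw [map_mul, conjLocal_toLocalRing, conjLocal_algebraMap, map_inv₀, hcδ, inv_neg, map_neg, mul_neg]

omit [Algebra.IsQuadraticExtension F E] in
/-- the coercion of `X⁻¹`: `↑((ι_v(x)·δ)⁻¹) = ι_v(x⁻¹) · (δ ⊗ 1)⁻¹`. [cite: CasselsFrohlichANT1967, Ch. II §10] -/
theorem val_inv_coordUnit (x : (v.adicCompletion F)ˣ) :
    (((Units.map (UnitaryGroup.toLocalRing E v : v.adicCompletion F →* UnitaryGroup.LocalRing E v) x *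
        (Units.mk0 δ hδ).map (algebraMap E (UnitaryGroup.LocalRing E v) : E →* UnitaryGroup.LocalRing E v))⁻¹ : (UnitaryGroup.LocalRing E v)ˣ) :
        UnitaryGroup.LocalRing E v) =
      UnitaryGroup.toLocalRing E v ((x⁻¹ : (v.adicCompletion F)ˣ) : v.adicCompletion F) * algebraMap E (UnitaryGroup.LocalRing E v) δ⁻¹ := by
  rw [mul_inv, ← map_inv, ← map_inv, Units.val_mul, Units.coe_map, Units.coe_map]
  simp only [Units.val_inv_eq_inv_val, Units.val_mk0]
  rfl

omit [Algebra.IsQuadraticExtension F E] in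
/-- two skew proofs give the same root letter (for rewriting the parameter). [cite: HarrisKudlaSweet1996, §1 (1.11)] -/
theorem uLongTwo_congr {x x' : UnitaryGroup.LocalRing E v} (hx : UnitaryGroup.conjLocal E c v x = -x) (hx' : UnitaryGroup.conjLocal E c v x' = -x')
    (h : x = x') :
    uLongTwo (UnitaryGroup.LocalRing E v) (UnitaryGroup.conjLocal E c v) x hx = uLongTwo (UnitaryGroup.LocalRing E v) (UnitaryGroup.conjLocal E c v) x' hx' := by
  subst h; rfl

/-- `((r⁻¹)²)^{s+1} = r^{−(2s+2)}` for `r > 0` (real base, complex exponent). [folklore] -/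
theorem ofReal_inv_sq_cpow {r : ℝ} (hr : 0 < r) (s : ℂ) :
    (((r⁻¹) ^ 2 : ℝ) : ℂ) ^ (s + 1) = ((r : ℝ) : ℂ) ^ (-(2 * s + 2)) := by
  have h1 : (((r⁻¹) ^ 2 : ℝ) : ℂ) ≠ 0 := Complex.ofReal_ne_zero.2 (by positivity)
  have h2 : ((r : ℝ) : ℂ) ≠ 0 := Complex.ofReal_ne_zero.2 hr.ne'
  rw [Complex.cpow_def_of_ne_zero h1, Complex.cpow_def_of_ne_zero h2, ← Complex.ofReal_log (by positivity), ← Complex.ofReal_log hr.le,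
    Real.log_pow, Real.log_inv]
  congr 1
  push_cast
  ring

include hJ₂D hDD hQm in
/-- **the torus character on the coordinate line**: `χ_s(φ t(ι_v(y), 1)) = χ_{F,v}(y) · (|y|_v²)^{s+1}` (★ B1b-2c (L2): `(∏_w χ_w(ι_w y)) (∏_w ‖ι_w y‖)^{s+1}`,
★ `chiF`, ★ `prod_norm_toPlace_eq_sq`). [cite: HarrisKudlaSweet1996, §1 (1.15), §6 (6.14)] [cite: CasselsFrohlichANT1967, Ch. II §11] -/
theorem localSiegelCharacter_frameConj_torusElt_coord (y : (v.adicCompletion F)ˣ) :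
    localSiegelCharacter F E c v 2 χv s (FrameTransport.frameConj F E c v (2 + 2) hJ₂D (antidiagonal_over_eq_map F E 2) Q hQ (toLocalFour F E c v (torusElt (UnitaryGroup.LocalRing E v) (UnitaryGroup.conjLocal E c v) (UnitaryGroup.conjLocal_conjLocal c v hcδ hδ)
          (Units.map (UnitaryGroup.toLocalRing E v : v.adicCompletion F →* UnitaryGroup.LocalRing E v) y) 1))) =
      ((chiF F E v χv y : ℂˣ) : ℂ) * (((‖(y : v.adicCompletion F)‖ ^ 2 : ℝ) : ℂ) ^ (s + 1)) := by
  rw [localSiegelCharacter_frameConj_torusElt F E c hcδ hδ v hJ₂D D Dinv hDD Q hQm hQ χv s, mul_one, chiF_apply, Units.coe_prod,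
    ← prod_norm_toPlace_eq_sq F E v]
  congr 3
  exact Finset.prod_congr rfl fun w _ => by rw [Units.val_one, Pi.one_apply, mul_one]; rfl

include hJ₂D hDD hQm in
/-- **the value the first `α₂`-step consumes**: `χ_s(φ t(ι_v(x⁻¹), 1)) = χ_{F,v}(x)⁻¹ · |x|_v^{−(2s+2)}` (`|·|_v = normAbs`, the currency of
★ `K2LiuRankOneOperators`). [cite: HarrisKudlaSweet1996, §1 (1.15), §6 (6.14)] [cite: Casselman1980, §3] -/
theorem localSiegelCharacter_frameConj_torusElt_coord_inv (x : (v.adicCompletion F)ˣ) :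
    localSiegelCharacter F E c v 2 χv s (FrameTransport.frameConj F E c v (2 + 2) hJ₂D (antidiagonal_over_eq_map F E 2) Q hQ (toLocalFour F E c v (torusElt (UnitaryGroup.LocalRing E v) (UnitaryGroup.conjLocal E c v) (UnitaryGroup.conjLocal_conjLocal c v hcδ hδ)
          (Units.map (UnitaryGroup.toLocalRing E v : v.adicCompletion F →* UnitaryGroup.LocalRing E v) x⁻¹) 1))) =
      (((chiF F E v χv x)⁻¹ : ℂˣ) : ℂ) * ((normAbs (v.adicCompletion F) (x : v.adicCompletion F) : ℝ) : ℂ) ^ (-(2 * s + 2)) := by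
  have hx0 : (0 : ℝ) < ‖(x : v.adicCompletion F)‖ := norm_pos_iff.2 x.ne_zero
  rw [localSiegelCharacter_frameConj_torusElt_coord F E c hcδ hδ v hJ₂D D Dinv hDD Q hQm hQ χv s x⁻¹, map_inv]
  simp only [Units.val_inv_eq_inv_val, norm_inv]
  rw [ofReal_inv_sq_cpow hx0, norm_eq_coe_normAbs F v]

end Coordinates

/-! ## §4 The long-root relation in `F_v`-coordinates (for any `F` with (N) for `u_{2e₂}` and a torus law `θ`) -/

section Relation

omit [Algebra.IsQuadraticExtension F E] in
include hcδ in
/-- **the root letter is additive in the coordinate**: `u(y + y′) = u(y) u(y′)` for `u(y) := φ(u_{2e₂}(ι_v(y)δ))` (★ `uLongTwo_mul`) — the `hu_add` binder of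
★ `K2LiuRankOneOperators`. [cite: HarrisKudlaSweet1996, §1 (1.11)] -/
theorem frameConj_uLongTwo_coord_add (y y' : v.adicCompletion F) :
    FrameTransport.frameConj F E c v (2 + 2) hJ₂D (antidiagonal_over_eq_map F E 2) Q hQ (toLocalFour F E c v (uLongTwo (UnitaryGroup.LocalRing E v) (UnitaryGroup.conjLocal E c v)
          (UnitaryGroup.toLocalRing E v (y + y') * algebraMap E (UnitaryGroup.LocalRing E v) δ) (conjLocal_coord F E c hcδ v (y + y')))) =
      FrameTransport.frameConj F E c v (2 + 2) hJ₂D (antidiagonal_over_eq_map F E 2) Q hQ (toLocalFour F E c v (uLongTwo (UnitaryGroup.LocalRing E v) (UnitaryGroup.conjLocal E c v)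
            (UnitaryGroup.toLocalRing E v y * algebraMap E (UnitaryGroup.LocalRing E v) δ) (conjLocal_coord F E c hcδ v y))) *
        FrameTransport.frameConj F E c v (2 + 2) hJ₂D (antidiagonal_over_eq_map F E 2) Q hQ (toLocalFour F E c v (uLongTwo (UnitaryGroup.LocalRing E v) (UnitaryGroup.conjLocal E c v)
            (UnitaryGroup.toLocalRing E v y' * algebraMap E (UnitaryGroup.LocalRing E v) δ) (conjLocal_coord F E c hcδ v y'))) := by
  have h : uLongTwo (UnitaryGroup.LocalRing E v) (UnitaryGroup.conjLocal E c v)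
        (UnitaryGroup.toLocalRing E v (y + y') * algebraMap E (UnitaryGroup.LocalRing E v) δ) (conjLocal_coord F E c hcδ v (y + y')) =
      uLongTwo (UnitaryGroup.LocalRing E v) (UnitaryGroup.conjLocal E c v)
          (UnitaryGroup.toLocalRing E v y * algebraMap E (UnitaryGroup.LocalRing E v) δ) (conjLocal_coord F E c hcδ v y) *
        uLongTwo (UnitaryGroup.LocalRing E v) (UnitaryGroup.conjLocal E c v)
          (UnitaryGroup.toLocalRing E v y' * algebraMap E (UnitaryGroup.LocalRing E v) δ) (conjLocal_coord F E c hcδ v y') := by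
    rw [uLongTwo_mul]
    exact uLongTwo_congr F E c v _ _ (by rw [map_add, add_mul])
  rw [h, map_mul, map_mul]

include hcδ hδ in
/-- **THE LONG-ROOT RELATION IN `F_v`-COORDINATES.**  For `F : H_v → ℂ` with (N) for `φ(u_{2e₂}(r))` and torus law `θ`, and `x ∈ F_vˣ`:
`F(φ(w₂) · u(x) · g) = θ 1 (−X⁻¹) · F(ū(x⁻¹) · g)`, `X = ι_v(x)δ`, `u(y) = φ(u_{2e₂}(ι_v(y)δ))`, `ū(t) = φ(w₂) φ(u_{2e₂}(ι_v(t)δ⁻¹)) φ(w₂)` — ★ B4d-1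
`apply_weylTwo_uLongTwo` at the skew unit `X`, with `X⁻¹ = ι_v(x⁻¹) δ⁻¹`; the `hrel` binder of ★ `K2LiuRankOneOperators.integrable_and_integral_eq` up to the
evaluation of `θ 1 (−X⁻¹)` (§3 for Siegel sections). [cite: Casselman1980, §3] [cite: HarrisKudlaSweet1996, §1 (1.15)] -/
theorem apply_weylTwo_uLongTwo_coord (F' : UnitaryGroup.localPi E c (2 + 2) J₂D v → ℂ)
    (θ : (UnitaryGroup.LocalRing E v)ˣ → (UnitaryGroup.LocalRing E v)ˣ → ℂ)
    (hU : ∀ (r : UnitaryGroup.LocalRing E v) (hr : UnitaryGroup.conjLocal E c v r = -r) (g : UnitaryGroup.localPi E c (2 + 2) J₂D v),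
      F' (FrameTransport.frameConj F E c v (2 + 2) hJ₂D (antidiagonal_over_eq_map F E 2) Q hQ (toLocalFour F E c v (uLongTwo (UnitaryGroup.LocalRing E v) (UnitaryGroup.conjLocal E c v) r hr)) * g) = F' g)
    (hT : ∀ (a b : (UnitaryGroup.LocalRing E v)ˣ) (g : UnitaryGroup.localPi E c (2 + 2) J₂D v),
      F' (FrameTransport.frameConj F E c v (2 + 2) hJ₂D (antidiagonal_over_eq_map F E 2) Q hQ (toLocalFour F E c v (torusElt (UnitaryGroup.LocalRing E v) (UnitaryGroup.conjLocal E c v)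
          (UnitaryGroup.conjLocal_conjLocal c v hcδ hδ) a b)) * g) = θ a b * F' g)
    (x : (v.adicCompletion F)ˣ) (g : UnitaryGroup.localPi E c (2 + 2) J₂D v) :
    F' (FrameTransport.frameConj F E c v (2 + 2) hJ₂D (antidiagonal_over_eq_map F E 2) Q hQ (toLocalFour F E c v (weylTwo (UnitaryGroup.LocalRing E v) (UnitaryGroup.conjLocal E c v))) *
        FrameTransport.frameConj F E c v (2 + 2) hJ₂D (antidiagonal_over_eq_map F E 2) Q hQ (toLocalFour F E c v (uLongTwo (UnitaryGroup.LocalRing E v) (UnitaryGroup.conjLocal E c v)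
            (UnitaryGroup.toLocalRing E v (x : v.adicCompletion F) * algebraMap E (UnitaryGroup.LocalRing E v) δ) (conjLocal_coord F E c hcδ v x))) * g) =
      θ 1 (-(Units.map (UnitaryGroup.toLocalRing E v : v.adicCompletion F →* UnitaryGroup.LocalRing E v) x *
          (Units.mk0 δ hδ).map (algebraMap E (UnitaryGroup.LocalRing E v) : E →* UnitaryGroup.LocalRing E v))⁻¹) *
        F' (FrameTransport.frameConj F E c v (2 + 2) hJ₂D (antidiagonal_over_eq_map F E 2) Q hQ (toLocalFour F E c v (weylTwo (UnitaryGroup.LocalRing E v) (UnitaryGroup.conjLocal E c v))) *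
            FrameTransport.frameConj F E c v (2 + 2) hJ₂D (antidiagonal_over_eq_map F E 2) Q hQ (toLocalFour F E c v (uLongTwo (UnitaryGroup.LocalRing E v) (UnitaryGroup.conjLocal E c v)
                (UnitaryGroup.toLocalRing E v ((x⁻¹ : (v.adicCompletion F)ˣ) : v.adicCompletion F) * algebraMap E (UnitaryGroup.LocalRing E v) δ⁻¹)
                (conjLocal_coord_inv F E c hcδ v _))) *
            FrameTransport.frameConj F E c v (2 + 2) hJ₂D (antidiagonal_over_eq_map F E 2) Q hQ (toLocalFour F E c v (weylTwo (UnitaryGroup.LocalRing E v) (UnitaryGroup.conjLocal E c v))) * g) := by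
  have HX : UnitaryGroup.conjLocal E c v ((Units.map (UnitaryGroup.toLocalRing E v : v.adicCompletion F →* UnitaryGroup.LocalRing E v) x *
      (Units.mk0 δ hδ).map (algebraMap E (UnitaryGroup.LocalRing E v) : E →* UnitaryGroup.LocalRing E v) : (UnitaryGroup.LocalRing E v)ˣ) : _) =
      -((Units.map (UnitaryGroup.toLocalRing E v : v.adicCompletion F →* UnitaryGroup.LocalRing E v) x *
      (Units.mk0 δ hδ).map (algebraMap E (UnitaryGroup.LocalRing E v) : E →* UnitaryGroup.LocalRing E v) : (UnitaryGroup.LocalRing E v)ˣ) : _) := by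
    rw [val_coordUnit]; exact conjLocal_coord F E c hcδ v x
  have h := apply_weylTwo_uLongTwo F E c hcδ hδ v hJ₂D Q hQ F' θ hU hT _ HX g
  have e2 := uLongTwo_congr F E c v (skew_inv HX) (conjLocal_coord_inv F E c hcδ v _) (val_inv_coordUnit F E hδ v x)
  rw [e2] at h
  simp only [map_mul] at h
  exact h

include hd hT₂ hJ₂D hDD hQm in
/-- **THE `hrel` DATUM OF THE FIRST `α₂`-STEP FOR A SIEGEL SECTION**: for `f ∈ I_v(s, χ_v)` and `x ∈ F_vˣ`,
`f(φ(w₂) u(x) g) = C₀(s) · χ_{F,v}(x)⁻¹ · |x|_v^{−(2s+2)} · f(ū(x⁻¹) g)` with **`C₀(s) = χ_s(φ t(1, −δ⁻¹))`** (§1 (N), §2 (T), §3, §4).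
[cite: Casselman1980, §3 Thm. 3.1] [cite: HarrisKudlaSweet1996, §1 (1.15), §6 (6.14)] -/
theorem apply_weylTwo_uLongTwo_coord_of_isLocalSiegelSection (χv : ∀ w : PlacesOver E v, (w.1.adicCompletion E)ˣ →* ℂˣ) (s : ℂ)
    {f : UnitaryGroup.localPi E c (2 + 2) J₂D v → ℂ} (hf : IsLocalSiegelSection F E c hcδ hδ hd v 2 hT₂ hJ₂D χv s f)
    (x : (v.adicCompletion F)ˣ) (g : UnitaryGroup.localPi E c (2 + 2) J₂D v) :
    f (FrameTransport.frameConj F E c v (2 + 2) hJ₂D (antidiagonal_over_eq_map F E 2) Q hQ (toLocalFour F E c v (weylTwo (UnitaryGroup.LocalRing E v) (UnitaryGroup.conjLocal E c v))) *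
        FrameTransport.frameConj F E c v (2 + 2) hJ₂D (antidiagonal_over_eq_map F E 2) Q hQ (toLocalFour F E c v (uLongTwo (UnitaryGroup.LocalRing E v) (UnitaryGroup.conjLocal E c v)
            (UnitaryGroup.toLocalRing E v (x : v.adicCompletion F) * algebraMap E (UnitaryGroup.LocalRing E v) δ) (conjLocal_coord F E c hcδ v x))) * g) =
      localSiegelCharacter F E c v 2 χv s (FrameTransport.frameConj F E c v (2 + 2) hJ₂D (antidiagonal_over_eq_map F E 2) Q hQ (toLocalFour F E c v (torusElt (UnitaryGroup.LocalRing E v) (UnitaryGroup.conjLocal E c v) (UnitaryGroup.conjLocal_conjLocal c v hcδ hδ) 1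
            (-((Units.mk0 δ hδ).map (algebraMap E (UnitaryGroup.LocalRing E v) : E →* UnitaryGroup.LocalRing E v))⁻¹)))) *
        (((chiF F E v χv x)⁻¹ : ℂˣ) : ℂ) * ((normAbs (v.adicCompletion F) (x : v.adicCompletion F) : ℝ) : ℂ) ^ (-(2 * s + 2)) *
        f (FrameTransport.frameConj F E c v (2 + 2) hJ₂D (antidiagonal_over_eq_map F E 2) Q hQ (toLocalFour F E c v (weylTwo (UnitaryGroup.LocalRing E v) (UnitaryGroup.conjLocal E c v))) *
            FrameTransport.frameConj F E c v (2 + 2) hJ₂D (antidiagonal_over_eq_map F E 2) Q hQ (toLocalFour F E c v (uLongTwo (UnitaryGroup.LocalRing E v) (UnitaryGroup.conjLocal E c v)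
                (UnitaryGroup.toLocalRing E v ((x⁻¹ : (v.adicCompletion F)ˣ) : v.adicCompletion F) * algebraMap E (UnitaryGroup.LocalRing E v) δ⁻¹)
                (conjLocal_coord_inv F E c hcδ v _))) *
            FrameTransport.frameConj F E c v (2 + 2) hJ₂D (antidiagonal_over_eq_map F E 2) Q hQ (toLocalFour F E c v (weylTwo (UnitaryGroup.LocalRing E v) (UnitaryGroup.conjLocal E c v))) * g) := by
  rw [apply_weylTwo_uLongTwo_coord F E c hcδ hδ v hJ₂D Q hQ f _ (apply_frameConj_uLongTwo F E c hcδ hδ hd v hT₂ hJ₂D D Dinv hDD Q hQm hQ hf)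
    (apply_frameConj_torusElt F E c hcδ hδ hd v hT₂ hJ₂D D Dinv hDD Q hQm hQ χv s hf) x g, neg_inv_coordUnit]
  -- `χ_s(φ t(1, b b′)) = χ_s(φ t(1, b)) χ_s(φ t(1, b′))`, then `χ_s(φ t(1, ι(x⁻¹))) = χ_s(φ t(ι(x⁻¹), 1)) = χ_F(x)⁻¹ |x|^{-(2s+2)}`
  have hsplit := localSiegelCharacter_frameConj_torusElt_mul F E c hcδ hδ hd v hT₂ hJ₂D D Dinv hDD Q hQm hQ χv s 1
    (Units.map (UnitaryGroup.toLocalRing E v : v.adicCompletion F →* UnitaryGroup.LocalRing E v) x⁻¹) 1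
    (-((Units.mk0 δ hδ).map (algebraMap E (UnitaryGroup.LocalRing E v) : E →* UnitaryGroup.LocalRing E v))⁻¹)
  rw [one_mul] at hsplit
  rw [hsplit, localSiegelCharacter_frameConj_torusElt_one_left F E c hcδ hδ v hJ₂D D Dinv hDD Q hQm hQ χv s (Units.map _ x⁻¹),
    localSiegelCharacter_frameConj_torusElt_coord_inv F E c hcδ hδ v hJ₂D D Dinv hDD Q hQm hQ χv s x]
  ring

end Relation

end Summit.HodgeConjecture.HodgeConjecture.Cruxes.HLiu418.K2LiuSiegelCocycleLetters

end
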